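import Mathlib
import HarnessLib
import Summits.HubbardSuperconductivity.HubbardSuperconductivity.Theorems.KLProgrammeKLRegimeEngineTowerImportWtArrays
import Summits.HubbardSuperconductivity.HubbardSuperconductivity.Theorems.KLProgrammeKLRegimeEngineTowerImportRowsPlain

/-!
# Route `KLProgramme` — crux K3 ENGINE (stmt-HubbardSuperconductivity-20437 `KLRegimeEngineV17F2`), register item «(b)-WT4» (pen (R355)): THE THREE WEIGHTED IMPORT ROWS
# `ι₁ʷ ι₂ʷ ι₃ʷ` OF THE WEIGHTED TOWER LAW IN FLOOR UNITS AND IN THE `(M/β)`-SHAPES, FROM WEIGHTED PLAIN LINES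
# (cell gate-hubbard-kl, seat hubbard-kl-k3c2-p3 g15, row «sector-counting import»; the weighted twin of `…TowerImportRowsPlain`, p695324)

k3c3-p2 g17's «(b)-WT4» design (KL STATUS 2026-08-29 04:54Z, (B)) keys the weighted law on the measured arrays in the track-`0` floor units,
`μ k m := W·Z^m·klTowerMeasWtAt … d k j (2m) / klLevUnitF β M 0 m (dk−1)`, with the two-, four- and six-leg rows imported at every block.  `…TowerImportWtArrays` (p697212)
bounds `klTowerMeasWtAt … d k j 2/4/6` by (one-anchor count) × `CW^{2m}` × (weighted plain line); the counts' `sectorCount (dk−1) = 2·2^{dk−1}` and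
`|SectorLeg (sectorCount (dk−1))|⁴ = 4096·2^{4(dk−1)}` cancel the units' `2^{(3m−5)(dk−1)}`, and `1/ε_x^{2m−1} = (2·M/β)^{2m−1}` gives the shapes:

* **`importRowsWt_of_wplainLines_flow_all (d R c″)`** — `∃ CW > 0` (ONE constant for the three rows): under the flow-frame binders of `…TowerImportWt` plus the four count
  doors, for every block (`1 ≤ dk−1 ≤ n`), rate `j ≥ dk−1`, all `W Z λ s₂ s₄ s₆ ≥ 0`, the `klScaleWt_j`-weighted PLAIN pinned lines of `𝒱_{dk}[K_n]` bounded by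
  `s₂·4^{−(dk−1)}·λ`, `s₄·λ`, `s₆·λ²`, and the EQUATIONAL closed forms `i₁ = 2·W·Z·klThinCount2C·CW²·s₂`, `i₂ = 16·W·Z²·klThinCountC·CW⁴·s₄`,
  `x₆ = 131072·W·Z³·klThinCount6C·CW⁶·s₆`:
  `W·Z^1·klTowerMeasWtAt … d k j 2 / klLevUnitF β M 0 1 (dk−1) ≤ (i₁·(M/β))·λ`, `W·Z^2·klTowerMeasWtAt … d k j 4 / klLevUnitF β M 0 2 (dk−1) ≤ (i₂·(M/β)³)·λ`,
  `W·Z^3·klTowerMeasWtAt … d k j 6 / klLevUnitF β M 0 3 (dk−1) ≤ (x₆·(M/β)⁵)·λ²`.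
Proofs only (arithmetic over p697212); the weighted plain lines stay hypotheses (E1); nothing asserts (ℓ), `KernelNormsWt4`, any stub, K3 or superconductivity.
References: BGM 2006 §2.7 (2.71a), §2.8 (2.76)–(2.77), (2.96) [cite: BenfattoGiulianiMastropietro2006].
-/

noncomputable section

namespace Summit.HubbardSuperconductivity.HubbardSuperconductivity.Theorems.EngineV8

set_option linter.dupNamespace false -- summit = problem name (single-conjunct summit), D-0017

open Classical
open Real Finset Literature.MathematicalPhysics.QuantumLattice Literature.Probability.LatticeModels GrassmannAlgebra
open Literature.MathematicalPhysics.QuantumLattice.FermiRG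
open Summit.HubbardSuperconductivity.HubbardSuperconductivity.Theorems.KLProgrammeLegKernels
open Summit.HubbardSuperconductivity.HubbardSuperconductivity.Theorems.KLRegimeSplit
open Summit.HubbardSuperconductivity.HubbardSuperconductivity.Theorems.TorusFourierL2
open Summit.HubbardSuperconductivity.HubbardSuperconductivity.Theorems.DispersionFlow
open Summit.HubbardSuperconductivity.HubbardSuperconductivity.Theorems.KLRegimeWick

set_option maxHeartbeats 400000 in -- three long flow-frame binder lists instantiated side by side
/-- **THE THREE WEIGHTED IMPORT ROWS IN FLOOR UNITS AND `(M/β)`-SHAPES FROM WEIGHTED PLAIN LINES** (see the module docstring).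
[cite: BenfattoGiulianiMastropietro2006, §2.7 (2.71a), §2.8 (2.76)-(2.77), (2.96)] -/
theorem importRowsWt_of_wplainLines_flow_all (d : ℕ) (R : RenConsts) (c'' : ℝ) (hc'' : 0 ≤ c'') :
    ∃ CW : ℝ, 0 < CW ∧
      ∀ (G : GeoConsts) (P : SplitConsts) (Q : EngConsts) (cc : ℝ), R.WF2 → 0 < cc → cc ≤ klEngC₃6 P R →
      cc ≤ klThinCountC₃ R → cc ≤ klThinCount6C₃ R → cc ≤ klThinCount2C₃ R →
      ∀ μ ∈ klWindowC, ∀ U : ℝ, 0 < U → U ≤ min (klEngU₀3 P R cc) (1 / (R.Gfr 3 + 1)) →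
      U ≤ klThinCountU₀ R → U ≤ klThinCount6U₀ R → U ≤ klThinCount2U₀ R → c'' * U ≤ 1 →
      ∀ β : ℝ, klBetaMin ≤ β → β ≤ Real.exp (cc / U ^ 2) →
      ∀ (L M : ℕ) [NeZero L] [NeZero M], klEngL₃ β U ≤ L → klEngM₃ β U L ≤ M →
      ∀ n : ℕ, 1 ≤ n → n ≤ nScales β + 1 → IsKLRegime U cc (-(n : ℤ)) → HistP klPredsV17F2 L M G P Q R β U μ 0 n →
        (∀ m', 1 ≤ m' → m' < n → FlowPieceOscAt L M c'' β U μ m') →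
      ∀ k j : ℕ, 1 ≤ d * k - 1 → d * k - 1 ≤ n → d * k - 1 ≤ j →
      ∀ (W Z lam s₂ s₄ s₆ : ℝ), 0 ≤ W → 0 ≤ Z → 0 ≤ lam → 0 ≤ s₂ → 0 ≤ s₄ → 0 ≤ s₆ →
        (∀ (q : Fin 2) (τ' : Fin 2 → SectorLeg 1) (y' : SpaceTimeIdx L M),
          imagTimeWeight β M ^ 1 * ∑ x' ∈ univ.filter (fun x' : Fin 2 → SpaceTimeIdx L M => x' q = y'),
            klScaleWt L M β j ((univ.image x').image (fun x : SpaceTimeIdx L M => (((((2 * (x.1 : ℕ) : ℕ)) : ZMod (2 * (2 * M)))), x.2))) *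
              ‖sectorisedKernel L M β (trivialMultiplier L M) (klTowerInput L M β U μ (klFlowFrameU L M β U μ n) d k) 2 τ' x'‖ ≤
            s₂ * ((4 : ℝ) ^ (d * k - 1))⁻¹ * lam) →
        (∀ (q : Fin 4) (τ' : Fin 4 → SectorLeg 1) (y' : SpaceTimeIdx L M),
          imagTimeWeight β M ^ 3 * ∑ x' ∈ univ.filter (fun x' : Fin 4 → SpaceTimeIdx L M => x' q = y'),
            klScaleWt L M β j ((univ.image x').image (fun x : SpaceTimeIdx L M => (((((2 * (x.1 : ℕ) : ℕ)) : ZMod (2 * (2 * M)))), x.2))) *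
              ‖sectorisedKernel L M β (trivialMultiplier L M) (klTowerInput L M β U μ (klFlowFrameU L M β U μ n) d k) 4 τ' x'‖ ≤ s₄ * lam) →
        (∀ (q : Fin 6) (τ' : Fin 6 → SectorLeg 1) (y' : SpaceTimeIdx L M),
          imagTimeWeight β M ^ 5 * ∑ x' ∈ univ.filter (fun x' : Fin 6 → SpaceTimeIdx L M => x' q = y'),
            klScaleWt L M β j ((univ.image x').image (fun x : SpaceTimeIdx L M => (((((2 * (x.1 : ℕ) : ℕ)) : ZMod (2 * (2 * M)))), x.2))) *
              ‖sectorisedKernel L M β (trivialMultiplier L M) (klTowerInput L M β U μ (klFlowFrameU L M β U μ n) d k) 6 τ' x'‖ ≤ s₆ * lam ^ 2) →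
      ∀ (i₁ i₂ x₆ : ℝ), i₁ = 2 * W * Z * klThinCount2C * CW ^ 2 * s₂ → i₂ = 16 * W * Z ^ 2 * klThinCountC * CW ^ 4 * s₄ →
        x₆ = 131072 * W * Z ^ 3 * klThinCount6C * CW ^ 6 * s₆ →
      W * Z ^ 1 * klTowerMeasWtAt L M β U μ (klFlowFrameU L M β U μ n) d k j 2 / klLevUnitF β M 0 1 (d * k - 1) ≤ (i₁ * ((M : ℝ) / β)) * lam ∧
      W * Z ^ 2 * klTowerMeasWtAt L M β U μ (klFlowFrameU L M β U μ n) d k j 4 / klLevUnitF β M 0 2 (d * k - 1) ≤ (i₂ * ((M : ℝ) / β) ^ 3) * lam ∧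
      W * Z ^ 3 * klTowerMeasWtAt L M β U μ (klFlowFrameU L M β U μ n) d k j 6 / klLevUnitF β M 0 3 (d * k - 1) ≤
        (x₆ * ((M : ℝ) / β) ^ 5) * lam ^ 2 := by
  obtain ⟨CW₁, hCW₁, h1⟩ := klTowerMeasWtAt_two_le_of_wplain_flow_all d R c'' hc''
  obtain ⟨CW₂, hCW₂, h2⟩ := klTowerMeasWtAt_four_le_of_wplain_flow_all d R c'' hc''
  obtain ⟨CW₃, hCW₃, h3⟩ := klTowerMeasWtAt_six_le_of_wplain_flow_all d R c'' hc''
  refine ⟨max CW₁ (max CW₂ CW₃), lt_max_of_lt_left hCW₁, ?_⟩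
  intro G P Q cc hR2 hcc hcc6 hccT hccT6 hccT2 μ hμ U hU hUle hUT hUT6 hUT2 hcU β hβmin hβc L M _ _ hL3 hM3 n hn1 hnN hreg hhist hosc
    k j hk1 hkn hkj W Z lam s₂ s₄ s₆ hW hZ hlam hs₂ hs₄ hs₆ hS₂ hS₄ hS₆ i₁ i₂ x₆ hi₁ hi₂ hx₆
  set CW := max CW₁ (max CW₂ CW₃) with hCWdef
  have hCW1 : CW₁ ≤ CW := le_max_left _ _
  have hCW2 : CW₂ ≤ CW := (le_max_left _ _).trans (le_max_right _ _)
  have hCW3 : CW₃ ≤ CW := (le_max_right _ _).trans (le_max_right _ _)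
  have hβ0 : 0 < β := KLRegimeSplit.pos_of_klBetaMin_le hβmin
  have hM0 : (0 : ℝ) < M := Nat.cast_pos.2 (Nat.pos_of_ne_zero (NeZero.ne M))
  have hε : 0 < imagTimeWeight β M := imagTimeWeight_pos_of_pos (M := M) hβ0
  have hεdef : imagTimeWeight β M = β / (2 * M) := rfl
  have hC2 : 0 ≤ klThinCount2C := klThinCount2C_pos.le
  have hC : 0 ≤ klThinCountC := klThinCountC_pos.le
  have hC6 : 0 ≤ klThinCount6C := klThinCount6C_pos.le
  set J := d * k - 1 with hJ
  set K : TrigPolyC4v := klFlowFrameU L M β U μ n with hKdef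
  have h4J : (0 : ℝ) < (4 : ℝ) ^ J := by positivity
  have h2J : (0 : ℝ) < (2 : ℝ) ^ J := by positivity
  have hsc : (sectorCount J : ℝ) = 2 * (2 : ℝ) ^ J := by simp [sectorCount, pow_succ, mul_comm]
  -- the currency: `(M/β)·ε_x = 1/2`
  have hr : ((M : ℝ) / β) * imagTimeWeight β M = 1 / 2 := by
    rw [hεdef, div_mul_div_comm, div_eq_div_iff (by positivity) (by norm_num)]
    ring
  have hr3 : ((M : ℝ) / β) ^ 3 * imagTimeWeight β M ^ 3 = 1 / 8 := by rw [← mul_pow, hr]; norm_num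
  have hr5 : ((M : ℝ) / β) ^ 5 * imagTimeWeight β M ^ 5 = 1 / 32 := by rw [← mul_pow, hr]; norm_num
  have hcard : (Fintype.card (SectorLeg (sectorCount J)) : ℝ) ^ 4 = 4096 * (2 : ℝ) ^ (4 * J) := by
    rw [card_sectorLeg_sectorCount, mul_pow, ← pow_mul, mul_comm J 4]; norm_num
  refine ⟨?_, ?_, ?_⟩
  · -- two legs: unit `ε_x/4^J`, count `klThinCount2C`
    have hS0 : 0 ≤ s₂ * ((4 : ℝ) ^ J)⁻¹ * lam := by positivity
    have hA := h1 G P Q cc hR2 hcc hcc6 hccT2 μ hμ U hU hUle hUT2 hcU β hβmin hβc L M hL3 hM3 n hn1 hnN hreg hhist hosc k j hk1 hkn hkj _ hS0 hS₂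
    have hpow : CW₁ ^ 2 ≤ CW ^ 2 := pow_le_pow_left₀ hCW₁.le hCW1 2
    have hu : 0 < klLevUnitF β M 0 1 J := klLevUnitF_pos hβ0 0 1 J
    rw [div_le_iff₀ hu, klLevUnitF_one_eq_of_gain_zero β M (show klLevGain (0 : Fin 5) = 0 from rfl) J]
    calc W * Z ^ 1 * klTowerMeasWtAt L M β U μ K d k j 2 ≤ W * Z ^ 1 * (klThinCount2C * (CW₁ ^ 2 * (s₂ * ((4 : ℝ) ^ J)⁻¹ * lam))) :=
          mul_le_mul_of_nonneg_left hA (by positivity)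
      _ ≤ W * Z ^ 1 * (klThinCount2C * (CW ^ 2 * (s₂ * ((4 : ℝ) ^ J)⁻¹ * lam))) := by gcongr
      _ = (i₁ * ((M : ℝ) / β)) * lam * (imagTimeWeight β M / (4 : ℝ) ^ J) := by
          subst hi₁
          linear_combination (-(2 * W * Z * klThinCount2C * CW ^ 2 * s₂ * lam * ((4 : ℝ) ^ J)⁻¹)) * hr
  · -- four legs: unit `ε_x³·2^J`, count `klThinCountC·sectorCount J`
    have hS0 : 0 ≤ s₄ * lam := by positivity
    have hA := h2 G P Q cc hR2 hcc hcc6 hccT μ hμ U hU hUle hUT hcU β hβmin hβc L M hL3 hM3 n hn1 hnN hreg hhist hosc k j hk1 hkn hkj _ hS0 hS₄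
    rw [hsc] at hA
    have hpow : CW₂ ^ 4 ≤ CW ^ 4 := pow_le_pow_left₀ hCW₂.le hCW2 4
    have hu : 0 < klLevUnitF β M 0 2 J := klLevUnitF_pos hβ0 0 2 J
    have hu2 : klLevUnitF β M 0 2 J = imagTimeWeight β M ^ 3 * (2 : ℝ) ^ J := by
      rw [klLevUnitF_two_eq, show klLevGain (0 : Fin 5) * J = 0 by rw [show klLevGain (0 : Fin 5) = 0 from rfl, zero_mul], pow_zero, div_one]
    rw [div_le_iff₀ hu, hu2]
    calc W * Z ^ 2 * klTowerMeasWtAt L M β U μ K d k j 4 ≤ W * Z ^ 2 * (klThinCountC * (2 * (2 : ℝ) ^ J) * (CW₂ ^ 4 * (s₄ * lam))) :=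
          mul_le_mul_of_nonneg_left hA (by positivity)
      _ ≤ W * Z ^ 2 * (klThinCountC * (2 * (2 : ℝ) ^ J) * (CW ^ 4 * (s₄ * lam))) := by gcongr
      _ = (i₂ * ((M : ℝ) / β) ^ 3) * lam * (imagTimeWeight β M ^ 3 * (2 : ℝ) ^ J) := by
          subst hi₂
          linear_combination (-(16 * (2 : ℝ) ^ J * W * Z ^ 2 * klThinCountC * CW ^ 4 * s₄ * lam)) * hr3
  · -- six legs: unit `ε_x⁵·2^{4J}`, count `klThinCount6C·|SectorLeg|⁴`
    have hS0 : 0 ≤ s₆ * lam ^ 2 := by positivity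
    have hA := h3 G P Q cc hR2 hcc hcc6 hccT6 μ hμ U hU hUle hUT6 hcU β hβmin hβc L M hL3 hM3 n hn1 hnN hreg hhist hosc k j hk1 hkn hkj _ hS0 hS₆
    rw [hcard] at hA
    have hpow : CW₃ ^ 6 ≤ CW ^ 6 := pow_le_pow_left₀ hCW₃.le hCW3 6
    have hu : 0 < klLevUnitF β M 0 3 J := klLevUnitF_pos hβ0 0 3 J
    have h24J : (0 : ℝ) < (2 : ℝ) ^ (4 * J) := by positivity
    rw [div_le_iff₀ hu, klLevUnitF_zero_three_eq]
    calc W * Z ^ 3 * klTowerMeasWtAt L M β U μ K d k j 6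
        ≤ W * Z ^ 3 * (klThinCount6C * (4096 * (2 : ℝ) ^ (4 * J)) * (CW₃ ^ 6 * (s₆ * lam ^ 2))) :=
          mul_le_mul_of_nonneg_left hA (by positivity)
      _ ≤ W * Z ^ 3 * (klThinCount6C * (4096 * (2 : ℝ) ^ (4 * J)) * (CW ^ 6 * (s₆ * lam ^ 2))) := by gcongr
      _ = (x₆ * ((M : ℝ) / β) ^ 5) * lam ^ 2 * (imagTimeWeight β M ^ 5 * (2 : ℝ) ^ (4 * J)) := by
          subst hx₆
          linear_combination (-(131072 * (2 : ℝ) ^ (4 * J) * W * Z ^ 3 * klThinCount6C * CW ^ 6 * s₆ * lam ^ 2)) * hr5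

end Summit.HubbardSuperconductivity.HubbardSuperconductivity.Theorems.EngineV8

end
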